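import Mathlib
import HarnessLib
import Summits.PneNP.PneNP.Theorems.CnfIdealGenLengthRankDefectRepresentationsCutLemmaCutDominationMatrix

/-!
# The cut lemma (registered stub `stub_cutLemma`, crux `RankDefectRepresentations` = stmt-PneNP-18923, line `rank-dehn-ladder`)

MAX-CUT DECOMPOSITION (Theorem 2 of `Cruxes/RankDefectRepresentations/Lines/rank-dehn-ladder-N1-proof.md`, lead g7): if the rows
and columns of `R` are coloured and `B` maximises the bipartition-cut rank
`μ(B) = rank R|_{(row∈B)×(col∉B)} + rank R|_{(row∉B)×(col∈B)}`, then `R` is within rank `4 μ(B)` of a COLOUR-BLOCK-DIAGONAL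
matrix (`exists_blockDiagonal_of_maxCut`).  Ingredients: a column-space lift (`exists_lift`), the private-dimension count
(`sum_rank_sub_erase_le`), and maximality of `B` against `B ∖ {i}` / `B ∪ {i}` only.  Combined with cut domination
(`…CutDominationMatrix.bipartitionCut_le_sum_coordinateCuts`: `μ(B) ≤ ∑_j rank (cut_j R)` for cube colourings) this proves the
registered negative rung N1 of the line with constants `C = 4`, `a = 1` — the assembly (`exists_blockDiagonal_of_maxCut`,
`stub_cutLemma`, and the additive cut inequality (A)) is in `…RankDefectRepresentationsCutLemma`; this file holds the one-sided
decomposition `oneSided_decomposition` and its tools.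
HONEST FRAMING: negative-lane tool for the crux; the item-deciding rung N0b (`stub_uniformStability`) remains open; P ≠ NP is not
moved; F-N2 is a FRONTIER formal rung.
-/

set_option linter.dupNamespace false -- `Summit.PneNP.PneNP.…`: summit = sub-problem name (D-0017)

namespace Summit.PneNP.PneNP.Theorems.CnfIdealGenLengthRankDefectRepresentationsCutLemmaMaxCut

open Finset Matrix Module
open Literature.Computability.AlgebraicComplexity (rank_add_le)
open Summit.PneNP.PneNP.Theorems.CnfIdealGenLengthRankDefectRepresentationsCutLemmaMonotoneCuts (rank_pad_le)
open Summit.PneNP.PneNP.Theorems.CnfIdealGenLengthRankDefectRepresentationsCutLemmaCutDominationMatrix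
  (rank_rowSelect_mono rank_rowSelect_submod bipartitionCut_le_sum_coordinateCuts)

variable {K : Type} [Field K]

section Tools

variable {ρ ι' : Type} [Fintype ρ] [Fintype ι']

/-- Rank of a finite sum of matrices is at most the sum of the ranks. [folklore] -/
theorem rank_finsetSum_le {α : Type} (s : Finset α) (A : α → Matrix ρ ι' K) :
    (∑ i ∈ s, A i).rank ≤ ∑ i ∈ s, (A i).rank := by
  classical
  induction s using Finset.induction_on with
  | empty => simp
  | insert a s ha ih =>
      rw [Finset.sum_insert ha, Finset.sum_insert ha]
      exact (rank_add_le _ _).trans (Nat.add_le_add_left ih _)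

/-- **Column-space lift.**  If `Q'` and `P'` have disjoint column supports, there is `Z` with
`rank (P' − Q' Z) + rank Q' ≤ rank (Q' + P')`: subtract from each column of `P'` its projection onto the column space of `Q'`
along a complement. [folklore] -/
theorem exists_lift (Q' P' : Matrix ρ ι' K) (q : ι' → Prop) [DecidablePred q]
    (hQ : ∀ x y, ¬ q y → Q' x y = 0) (hP : ∀ x y, q y → P' x y = 0) :
    ∃ Z : Matrix ι' ι' K, (P' - Q' * Z).rank + Q'.rank ≤ (Q' + P').rank := by
  classical
  set VQ : Submodule K (ρ → K) := Submodule.span K (Set.range Q'.col) with hVQ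
  set W : Submodule K (ρ → K) := Submodule.span K (Set.range (Q' + P').col) with hW
  obtain ⟨C, hC⟩ := VQ.exists_isCompl
  set π : (ρ → K) →ₗ[K] (ρ → K) := VQ.projection C hC with hπ
  have hPW : ∀ k, P'.col k ∈ W := by
    intro k
    by_cases hk : q k
    · have : P'.col k = 0 := by ext x; simp [Matrix.col_apply, hP x k hk]
      rw [this]; exact Submodule.zero_mem _
    · have : P'.col k = (Q' + P').col k := by ext x; simp [Matrix.col_apply, hQ x k hk]
      rw [this]; exact Submodule.subset_span ⟨k, rfl⟩
  have hQW : VQ ≤ W := by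
    apply Submodule.span_le.mpr
    rintro _ ⟨k, rfl⟩
    by_cases hk : q k
    · have : Q'.col k = (Q' + P').col k := by ext x; simp [Matrix.col_apply, hP x k hk]
      rw [this]; exact Submodule.subset_span ⟨k, rfl⟩
    · have : Q'.col k = 0 := by ext x; simp [Matrix.col_apply, hQ x k hk]
      rw [this]; exact Submodule.zero_mem _
  have hπmem : ∀ k, π (P'.col k) ∈ LinearMap.range Q'.mulVecLin := by
    intro k; rw [Matrix.range_mulVecLin]; exact Submodule.projection_apply_mem hC _
  choose z hz using hπmem
  refine ⟨Matrix.of fun a k => z k a, ?_⟩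
  set E : Matrix ρ ι' K := P' - Q' * Matrix.of fun a k => z k a with hE
  set φ : (ρ → K) →ₗ[K] (ρ → K) := LinearMap.id - π with hφ
  have hEcol : ∀ k, E.col k = φ (P'.col k) := by
    intro k
    have h1 : (Q' * Matrix.of fun a k => z k a).col k = Q' *ᵥ (z k) := by
      ext x; simp [Matrix.col_apply, Matrix.mul_apply, Matrix.mulVec, dotProduct]
    have h2 : Q' *ᵥ (z k) = π (P'.col k) := by rw [← hz k]; rfl
    have h3 : E.col k = P'.col k - (Q' * Matrix.of fun a k => z k a).col k := by
      ext x; simp [hE, Matrix.col_apply]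
    rw [h3, h1, h2, hφ, LinearMap.sub_apply, LinearMap.id_apply]
  -- `span (cols E) ≤ φ W`
  have hspan : Submodule.span K (Set.range E.col) ≤ W.map φ := by
    apply Submodule.span_le.mpr
    rintro _ ⟨k, rfl⟩
    rw [hEcol k]
    exact Submodule.mem_map_of_mem (hPW k)
  set f := φ.domRestrict W with hf
  have hrange : LinearMap.range f = W.map φ := LinearMap.range_domRestrict _ _
  have hrk := LinearMap.finrank_range_add_finrank_ker f
  -- `VQ ≤ ker f` (as a subspace of `W`)
  have hker : VQ.comap W.subtype ≤ LinearMap.ker f := by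
    intro w hw
    simp only [Submodule.mem_comap, Submodule.subtype_apply] at hw
    simp only [LinearMap.mem_ker, hf, LinearMap.domRestrict_apply, hφ, LinearMap.sub_apply, LinearMap.id_apply, hπ,
      Submodule.projection_apply_of_mem_left hC hw, sub_self]
  have hVQ : finrank K VQ ≤ finrank K (LinearMap.ker f) := by
    rw [← (Submodule.comapSubtypeEquivOfLe hQW).finrank_eq]
    exact Submodule.finrank_mono hker
  have hEle : E.rank ≤ finrank K (LinearMap.range f) := by
    rw [Matrix.rank_eq_finrank_span_cols, hrange]
    exact Submodule.finrank_mono hspan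
  rw [Matrix.rank_eq_finrank_span_cols Q', Matrix.rank_eq_finrank_span_cols (Q' + P')]
  change E.rank + finrank K VQ ≤ finrank K W
  omega

variable {Q : Type} [DecidableEq Q]

/-- **Private dimensions add up below the rank.**  For a row colouring `c` and a set `B` of colours, removing one colour class
`i ∈ C` at a time from the `B`-selected rows costs in total at most `rank M_B − rank M_{B ∖ C}`. [folklore] -/
theorem sum_rank_sub_erase_le (c : ρ → Q) (M : Matrix ρ ι' K) (B C : Finset Q) :
    ∑ i ∈ C, (((Matrix.of fun z y => if c z ∈ B then M z y else 0).rank : ℤ) -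
        ((Matrix.of fun z y => if c z ∈ B.erase i then M z y else 0).rank : ℤ)) +
      ((Matrix.of fun z y => if c z ∈ B \ C then M z y else 0).rank : ℤ) ≤
      ((Matrix.of fun z y => if c z ∈ B then M z y else 0).rank : ℤ) := by
  classical
  induction C using Finset.induction_on with
  | empty => simp
  | insert i C hi ih =>
      rw [Finset.sum_insert hi]
      have hs := rank_rowSelect_submod (K := K) c M (B.erase i) (B \ C)
      have e1 : B.erase i ∪ B \ C = B := by
        ext x; simp only [mem_union, mem_erase, mem_sdiff]
        constructor
        · rintro (⟨-, h⟩ | ⟨h, -⟩) <;> exact h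
        · intro h; by_cases hx : x = i
          · subst hx; exact Or.inr ⟨h, hi⟩
          · exact Or.inl ⟨hx, h⟩
      have e2 : B.erase i ∩ (B \ C) = B \ insert i C := by
        ext x; simp only [mem_inter, mem_erase, mem_sdiff, mem_insert, not_or]; tauto
      rw [e1, e2] at hs
      have hs' : ((Matrix.of fun z y => if c z ∈ B then M z y else 0).rank : ℤ) +
          ((Matrix.of fun z y => if c z ∈ B \ insert i C then M z y else 0).rank : ℤ) ≤
          ((Matrix.of fun z y => if c z ∈ B.erase i then M z y else 0).rank : ℤ) +
          ((Matrix.of fun z y => if c z ∈ B \ C then M z y else 0).rank : ℤ) := by exact_mod_cast hs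
      linarith

end Tools

section Decomposition

variable {ι ι' Q : Type} [Fintype ι] [Fintype ι'] [DecidableEq ι] [DecidableEq ι'] [DecidableEq Q]

omit [DecidableEq ι'] [DecidableEq Q] in
/-- Zeroing rows does not increase the rank. [folklore] -/
theorem rank_rowZero_le (p : ι → Prop) [DecidablePred p] (M : Matrix ι ι' K) :
    (Matrix.of fun x y => if p x then M x y else 0).rank ≤ M.rank := by
  have : (Matrix.of fun x y => if p x then M x y else 0) =
      Matrix.diagonal (fun x => if p x then (1 : K) else 0) * M := by
    ext x y; simp [Matrix.diagonal_mul]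
  rw [this]; exact Matrix.rank_mul_le_right _ _

omit [Fintype ι] [DecidableEq ι] [DecidableEq Q] in
/-- Zeroing columns does not increase the rank. [folklore] -/
theorem rank_colZero_le (q : ι' → Prop) [DecidablePred q] (M : Matrix ι ι' K) :
    (Matrix.of fun x y => if q y then M x y else 0).rank ≤ M.rank := by
  have : (Matrix.of fun x y => if q y then M x y else 0) =
      M * Matrix.diagonal (fun y => if q y then (1 : K) else 0) := by
    ext x y; simp [Matrix.mul_diagonal]
  rw [this]; exact Matrix.rank_mul_le_left _ _

/-- **One-sided max-cut decomposition.**  If `B` is maximal for the bipartition-cut rank against removing single colours,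
then the diagonal super-block `R|_{(row∈B)×(col∈B)}` is within rank `rank R|_{(row∈B)×(col∉B)} + μ(B)` of a colour-block-diagonal
matrix supported on `{row = col ∈ B}`. [folklore] -/
theorem oneSided_decomposition (row : ι → Q) (col : ι' → Q) (R : Matrix ι ι' K) (B : Finset Q)
    (hmax : ∀ i ∈ B,
      (Matrix.of fun x y => if row x ∈ B.erase i ∧ col y ∉ B.erase i then R x y else 0).rank +
        (Matrix.of fun x y => if row x ∉ B.erase i ∧ col y ∈ B.erase i then R x y else 0).rank ≤
      (Matrix.of fun x y => if row x ∈ B ∧ col y ∉ B then R x y else 0).rank +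
        (Matrix.of fun x y => if row x ∉ B ∧ col y ∈ B then R x y else 0).rank) :
    ∃ P'' : Matrix ι ι' K, (∀ x y, ¬ (row x = col y ∧ col y ∈ B) → P'' x y = 0) ∧
      ((Matrix.of fun x y => if row x ∈ B ∧ col y ∈ B then R x y else 0) - P'').rank ≤
        (Matrix.of fun x y => if row x ∈ B ∧ col y ∉ B then R x y else 0).rank +
        ((Matrix.of fun x y => if row x ∈ B ∧ col y ∉ B then R x y else 0).rank +
          (Matrix.of fun x y => if row x ∉ B ∧ col y ∈ B then R x y else 0).rank) := by
  classical
  -- names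
  set Qm : Matrix ι ι' K := Matrix.of fun x y => if row x ∈ B ∧ col y ∉ B then R x y else 0 with hQm
  set Sm : Matrix ι ι' K := Matrix.of fun x y => if row x ∉ B ∧ col y ∈ B then R x y else 0 with hSm
  set Pm : Matrix ι ι' K := Matrix.of fun x y => if row x ∈ B ∧ col y ∈ B then R x y else 0 with hPm
  -- for each colour `i ∈ B`: the partial blocks and the lift
  set Q' : Q → Matrix ι ι' K := fun i => Matrix.of fun x y => if row x ∈ B.erase i ∧ col y ∉ B then R x y else 0
    with hQ'
  set P' : Q → Matrix ι ι' K := fun i => Matrix.of fun x y => if row x ∈ B.erase i ∧ col y = i then R x y else 0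
    with hP'
  have hlift : ∀ i, i ∈ B → ∃ Z : Matrix ι' ι' K, (P' i - Q' i * Z).rank + (Q' i).rank ≤ (Q' i + P' i).rank := by
    intro i hi
    refine exists_lift (Q' i) (P' i) (fun y => col y ∉ B) (fun x y hy => ?_) (fun x y hy => ?_)
    · simp only [hQ', Matrix.of_apply]; rw [if_neg]; exact fun h => hy h.2
    · simp only [hP', Matrix.of_apply]; rw [if_neg]; rintro ⟨-, h⟩; exact hy (h ▸ hi)
  choose! Z hZ using hlift
  -- restrict `Z i` to the columns of colour `i`
  set Δ : Q → Matrix ι' ι' K := fun i => Matrix.diagonal fun y => if col y = i then (1 : K) else 0 with hΔ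
  set Zf : Q → Matrix ι' ι' K := fun i => Z i * Δ i with hZf
  set E : Q → Matrix ι ι' K := fun i => P' i - Q' i * Zf i with hEd
  -- entrywise facts
  have mulΔ : ∀ (A : Matrix ι ι' K) i x y, (A * Δ i) x y = if col y = i then A x y else 0 := by
    intro A i x y
    simp only [hΔ, Matrix.mul_diagonal]
    split_ifs <;> simp
  have fact1 : ∀ i x y, col y ≠ i → (Qm * Zf i) x y = 0 := by
    intro i x y h
    simp only [hZf, ← Matrix.mul_assoc, mulΔ, if_neg h]
  have fact2 : ∀ (W : Matrix ι' ι' K) x y, row x ∉ B → (Qm * W) x y = 0 := by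
    intro W x y hx
    simp only [Matrix.mul_apply, hQm, Matrix.of_apply]
    exact Finset.sum_eq_zero fun y' _ => by rw [if_neg (fun h => hx h.1), zero_mul]
  have fact3 : ∀ i (W : Matrix ι' ι' K) x y, (Q' i * W) x y = if row x ∈ B.erase i then (Qm * W) x y else 0 := by
    intro i W x y
    simp only [Matrix.mul_apply, hQ', hQm, Matrix.of_apply]
    by_cases hx : row x ∈ B.erase i
    · rw [if_pos hx]
      refine Finset.sum_congr rfl fun y' _ => ?_
      have hxB : row x ∈ B := (mem_erase.mp hx).2
      by_cases hy' : col y' ∉ B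
      · rw [if_pos ⟨hx, hy'⟩, if_pos ⟨hxB, hy'⟩]
      · rw [if_neg (fun h => hy' h.2), if_neg (fun h => hy' h.2)]
    · rw [if_neg hx]
      exact Finset.sum_eq_zero fun y' _ => by rw [if_neg (fun h => hx h.1), zero_mul]
  have hErank : ∀ i ∈ B, (E i).rank ≤ (P' i - Q' i * Z i).rank := by
    intro i hi
    have : E i = (P' i - Q' i * Z i) * Δ i := by
      ext x y
      simp only [hEd, hZf, Matrix.sub_apply, ← Matrix.mul_assoc, mulΔ]
      by_cases hy : col y = i
      · simp [hy]
      · rw [if_neg hy, if_neg hy, sub_zero]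
        simp only [hP', Matrix.of_apply]; rw [if_neg]; rintro ⟨-, h⟩; exact hy h
    rw [this]; exact Matrix.rank_mul_le_left _ _
  -- the `a_i` bound from maximality: rank (P' i − Q' i Z i) ≤ (rank Qm − rank Q' i) + (rank Sm − rank S_{−i})
  have ha : ∀ i ∈ B, ((P' i - Q' i * Z i).rank : ℤ) ≤
      ((Qm.rank : ℤ) - (Q' i).rank) +
      ((Sm.rank : ℤ) - (Matrix.of fun x y => if row x ∉ B ∧ col y ∈ B.erase i then R x y else 0).rank) := by
    intro i hi
    have h1 := hZ i hi
    have h2 := hmax i hi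
    -- `Q' i + P' i` is the first block of the cut `B.erase i`
    have e1 : Q' i + P' i = Matrix.of fun x y => if row x ∈ B.erase i ∧ col y ∉ B.erase i then R x y else 0 := by
      ext x y
      simp only [hQ', hP', Matrix.add_apply, Matrix.of_apply]
      have hmem : col y ∉ B.erase i ↔ (col y ∉ B ∨ col y = i) := by
        rw [mem_erase, not_and_or, not_not]; tauto
      by_cases hr : row x ∈ B.erase i
      · by_cases h1 : col y ∈ B
        · by_cases h2 : col y = i
          · rw [if_neg (fun h => h.2 h1), if_pos ⟨hr, h2⟩, if_pos ⟨hr, hmem.mpr (Or.inr h2)⟩, zero_add]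
          · rw [if_neg (fun h => h.2 h1), if_neg (fun h => h2 h.2),
              if_neg (fun h => (hmem.mp h.2).elim (fun h' => h' h1) h2), add_zero]
        · have h2 : col y ≠ i := fun h => h1 (h ▸ hi)
          rw [if_pos ⟨hr, h1⟩, if_neg (fun h => h2 h.2), if_pos ⟨hr, hmem.mpr (Or.inl h1)⟩, add_zero]
      · rw [if_neg (fun h => hr h.1), if_neg (fun h => hr h.1), if_neg (fun h => hr h.1), add_zero]
    -- the second block of the cut `B.erase i` contains `S_{−i}` (zero the rows of colour `i`)
    have e2 : (Matrix.of fun x y => if row x ∉ B ∧ col y ∈ B.erase i then R x y else 0).rank ≤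
        (Matrix.of fun x y => if row x ∉ B.erase i ∧ col y ∈ B.erase i then R x y else 0).rank := by
      have : (Matrix.of fun x y => if row x ∉ B ∧ col y ∈ B.erase i then R x y else 0) =
          Matrix.of fun x y => if row x ∉ B then
            (Matrix.of fun x y => if row x ∉ B.erase i ∧ col y ∈ B.erase i then R x y else (0 : K)) x y else 0 := by
        ext x y
        simp only [Matrix.of_apply]
        by_cases hx : row x ∈ B
        · rw [if_neg (fun h => h.1 hx), if_neg (not_not.mpr hx)]
        · rw [if_pos hx]
          by_cases hy : col y ∈ B.erase i
          · rw [if_pos ⟨hx, hy⟩, if_pos ⟨fun h => hx (mem_erase.mp h).2, hy⟩]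
          · rw [if_neg (fun h => hy h.2), if_neg (fun h => hy h.2)]
      rw [this]; exact rank_rowZero_le _ _
    rw [e1] at h1
    have h1' : ((P' i - Q' i * Z i).rank : ℤ) + (Q' i).rank ≤
        (Matrix.of fun x y => if row x ∈ B.erase i ∧ col y ∉ B.erase i then R x y else 0).rank := by exact_mod_cast h1
    have h2' : ((Matrix.of fun x y => if row x ∈ B.erase i ∧ col y ∉ B.erase i then R x y else 0).rank : ℤ) +
        (Matrix.of fun x y => if row x ∉ B.erase i ∧ col y ∈ B.erase i then R x y else 0).rank ≤
        (Qm.rank : ℤ) + Sm.rank := by exact_mod_cast h2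
    have e2' : ((Matrix.of fun x y => if row x ∉ B ∧ col y ∈ B.erase i then R x y else 0).rank : ℤ) ≤
        (Matrix.of fun x y => if row x ∉ B.erase i ∧ col y ∈ B.erase i then R x y else 0).rank := by exact_mod_cast e2
    linarith
  -- private dimensions: rows of `Qm` by row colour, columns of `Sm` by column colour
  have hq : ∑ i ∈ B, ((Qm.rank : ℤ) - (Q' i).rank) ≤ Qm.rank := by
    have main := sum_rank_sub_erase_le (K := K) row (Matrix.of fun x y => if col y ∉ B then R x y else (0 : K)) B B
    have e0 : ∀ S : Finset Q, (Matrix.of fun z y => if row z ∈ S then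
        (Matrix.of fun x y => if col y ∉ B then R x y else (0 : K)) z y else 0) =
        Matrix.of fun x y => if row x ∈ S ∧ col y ∉ B then R x y else 0 := by
      intro S; ext x y; simp only [Matrix.of_apply]; split_ifs <;> tauto
    simp only [e0, Finset.sdiff_self] at main
    have hz : ((Matrix.of fun x y => if row x ∈ (∅ : Finset Q) ∧ col y ∉ B then R x y else (0 : K)).rank : ℤ) ≥ 0 := by
      positivity
    simpa [hQm, hQ'] using (by linarith : ∑ i ∈ B, (((Matrix.of fun x y => if row x ∈ B ∧ col y ∉ B then R x y else (0:K)).rank : ℤ) -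
        ((Matrix.of fun x y => if row x ∈ B.erase i ∧ col y ∉ B then R x y else (0:K)).rank : ℤ)) ≤
        ((Matrix.of fun x y => if row x ∈ B ∧ col y ∉ B then R x y else (0:K)).rank : ℤ))
  have hs : ∑ i ∈ B, ((Sm.rank : ℤ) - (Matrix.of fun x y => if row x ∉ B ∧ col y ∈ B.erase i then R x y else 0).rank) ≤
      Sm.rank := by
    -- transpose: the column classes of `Sm` are the row classes of `Smᵀ`
    have main := sum_rank_sub_erase_le (K := K) col
      (Matrix.of fun (y : ι') (x : ι) => if row x ∉ B then R x y else (0 : K)) B B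
    have e0 : ∀ S : Finset Q, (Matrix.of fun (z : ι') (x : ι) => if col z ∈ S then
        (Matrix.of fun (y : ι') (x : ι) => if row x ∉ B then R x y else (0 : K)) z x else 0) =
        (Matrix.of fun x y => if row x ∉ B ∧ col y ∈ S then R x y else (0 : K)).transpose := by
      intro S; ext y x; simp only [Matrix.of_apply, Matrix.transpose_apply]; split_ifs <;> tauto
    simp only [e0, Matrix.rank_transpose, Finset.sdiff_self] at main
    have hz : ((Matrix.of fun x y => if row x ∉ B ∧ col y ∈ (∅ : Finset Q) then R x y else (0 : K)).rank : ℤ) ≥ 0 := by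
      positivity
    simpa [hSm] using (by linarith : ∑ i ∈ B, (((Matrix.of fun x y => if row x ∉ B ∧ col y ∈ B then R x y else (0:K)).rank : ℤ) -
        ((Matrix.of fun x y => if row x ∉ B ∧ col y ∈ B.erase i then R x y else (0:K)).rank : ℤ)) ≤
        ((Matrix.of fun x y => if row x ∉ B ∧ col y ∈ B then R x y else (0:K)).rank : ℤ))
  have hsumE : (∑ i ∈ B, ((E i).rank : ℤ)) ≤ (Qm.rank : ℤ) + Sm.rank := by
    have : ∀ i ∈ B, ((E i).rank : ℤ) ≤ ((Qm.rank : ℤ) - (Q' i).rank) +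
        ((Sm.rank : ℤ) - (Matrix.of fun x y => if row x ∉ B ∧ col y ∈ B.erase i then R x y else 0).rank) :=
      fun i hi => le_trans (by exact_mod_cast hErank i hi) (ha i hi)
    calc (∑ i ∈ B, ((E i).rank : ℤ)) ≤ ∑ i ∈ B, (((Qm.rank : ℤ) - (Q' i).rank) +
        ((Sm.rank : ℤ) - (Matrix.of fun x y => if row x ∉ B ∧ col y ∈ B.erase i then R x y else 0).rank)) :=
          Finset.sum_le_sum this
      _ ≤ (Qm.rank : ℤ) + Sm.rank := by rw [Finset.sum_add_distrib]; linarith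
  -- the colour-block-diagonal approximant
  set P'' : Matrix ι ι' K := Matrix.of fun x y =>
    if row x = col y ∧ col y ∈ B then R x y - (Qm * Zf (col y)) x y else 0 with hP''
  refine ⟨P'', fun x y hxy => by simp only [hP'', Matrix.of_apply, if_neg hxy], ?_⟩
  have hdec : Pm - P'' = Qm * (∑ i ∈ B, Zf i) + ∑ i ∈ B, E i := by
    ext x y
    have s1 : (Qm * ∑ i ∈ B, Zf i) x y = if col y ∈ B then (Qm * Zf (col y)) x y else 0 := by
      rw [Matrix.mul_sum, Matrix.sum_apply]
      by_cases hyB : col y ∈ B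
      · rw [if_pos hyB, Finset.sum_eq_single_of_mem (col y) hyB (fun i _ hi => fact1 i x y (Ne.symm hi))]
      · rw [if_neg hyB]; exact Finset.sum_eq_zero (fun i hi => fact1 i x y (fun h => hyB (h ▸ hi)))
    have s2 : ∀ i, E i x y = (if row x ∈ B.erase i ∧ col y = i then R x y else 0) -
        (if row x ∈ B.erase i then (Qm * Zf i) x y else 0) := by
      intro i; simp only [hEd, Matrix.sub_apply, hP', Matrix.of_apply, fact3]
    have s2' : ∀ i, col y ≠ i → E i x y = 0 := by
      intro i hne
      rw [s2, fact1 i x y hne, if_neg (show ¬ (row x ∈ B.erase i ∧ col y = i) from fun h => hne h.2)]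
      split_ifs <;> simp
    have s3 : (∑ i ∈ B, E i) x y = if col y ∈ B then E (col y) x y else 0 := by
      rw [Matrix.sum_apply]
      by_cases hyB : col y ∈ B
      · rw [if_pos hyB, Finset.sum_eq_single_of_mem (col y) hyB (fun i _ hi => s2' i (Ne.symm hi))]
      · rw [if_neg hyB]; exact Finset.sum_eq_zero (fun i hi => s2' i (fun h => hyB (h ▸ hi)))
    rw [Matrix.add_apply, s1, s3, Matrix.sub_apply]
    by_cases hyB : col y ∈ B
    · rw [if_pos hyB, if_pos hyB, s2]
      by_cases hxB : row x ∈ B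
      · by_cases hxi : row x = col y
        · have hne : row x ∉ B.erase (col y) := by simp [hxi]
          have vPm : Pm x y = R x y := by simp [hPm, hxB, hyB]
          have vP : P'' x y = R x y - (Qm * Zf (col y)) x y := by simp [hP'', hxi, hyB]
          have v3 : (if row x ∈ B.erase (col y) ∧ col y = col y then R x y else 0) = 0 := by simp [hne]
          have v4 : (if row x ∈ B.erase (col y) then (Qm * Zf (col y)) x y else 0) = 0 := by simp [hne]
          rw [vPm, vP, v3, v4]; ring
        · have hmem : row x ∈ B.erase (col y) := mem_erase.mpr ⟨hxi, hxB⟩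
          have vPm : Pm x y = R x y := by simp [hPm, hxB, hyB]
          have vP : P'' x y = 0 := by simp [hP'', hxi]
          have v3 : (if row x ∈ B.erase (col y) ∧ col y = col y then R x y else 0) = R x y := by simp [hmem]
          have v4 : (if row x ∈ B.erase (col y) then (Qm * Zf (col y)) x y else 0) = (Qm * Zf (col y)) x y := by
            simp [hmem]
          rw [vPm, vP, v3, v4]; ring
      · have hne : row x ∉ B.erase (col y) := fun h => hxB (mem_erase.mp h).2
        have hne' : ¬ (row x = col y ∧ col y ∈ B) := fun h => hxB (h.1 ▸ hyB)
        have vPm : Pm x y = 0 := by simp [hPm, hxB]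
        have vP : P'' x y = 0 := by simp [hP'', hne']
        have v3 : (if row x ∈ B.erase (col y) ∧ col y = col y then R x y else 0) = 0 := by simp [hne]
        have v4 : (if row x ∈ B.erase (col y) then (Qm * Zf (col y)) x y else 0) = 0 := by simp [hne]
        rw [vPm, vP, v3, v4, fact2 _ x y hxB]; ring
    · rw [if_neg hyB, if_neg hyB]
      have vPm : Pm x y = 0 := by simp [hPm, hyB]
      have vP : P'' x y = 0 := by simp [hP'', hyB]
      rw [vPm, vP]; ring
  rw [hdec]
  have r1 := Matrix.rank_mul_le_left Qm (∑ i ∈ B, Zf i)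
  have r2 := rank_finsetSum_le B E
  have r3 := rank_add_le (Qm * ∑ i ∈ B, Zf i) (∑ i ∈ B, E i)
  have r2' : ((∑ i ∈ B, E i).rank : ℤ) ≤ ∑ i ∈ B, ((E i).rank : ℤ) := by exact_mod_cast r2
  have : ((Qm * ∑ i ∈ B, Zf i + ∑ i ∈ B, E i).rank : ℤ) ≤ (Qm.rank : ℤ) + (Qm.rank + Sm.rank) := by
    have r1' : ((Qm * ∑ i ∈ B, Zf i).rank : ℤ) ≤ Qm.rank := by exact_mod_cast r1
    have r3' : ((Qm * ∑ i ∈ B, Zf i + ∑ i ∈ B, E i).rank : ℤ) ≤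
        (Qm * ∑ i ∈ B, Zf i).rank + (∑ i ∈ B, E i).rank := by exact_mod_cast r3
    linarith
  exact_mod_cast this

end Decomposition

end Summit.PneNP.PneNP.Theorems.CnfIdealGenLengthRankDefectRepresentationsCutLemmaMaxCut
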